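import Summits.BirchSwinnertonDyer.BirchSwinnertonDyer.Theorems.RamifiedHeegnerPairLeafPartnerPairingCore
import Summits.BirchSwinnertonDyer.BirchSwinnertonDyer.Theorems.RamifiedHeegnerPairLeafPartnerTwist
import Summits.BirchSwinnertonDyer.BirchSwinnertonDyer.Theorems.RamifiedHeegnerPairLeafRankOneUpperAtThreeShimuraInertPairingComposition
import HarnessLib

/-!
# Route `RamifiedHeegnerPair`, crux U₁ `LeafRankOneUpperAtThree` (stmt-BirchSwinnertonDyer-26022), line `partnerdescent` —
# ROAD-R1 on the ORPHAN-PAIRING rows, DERIVED from (G3), the partner genus display, the Friedberg–Hoffstein supply, PUB⁺, JL and L₀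
# (part 4b of the partner kernel: the wrapper that builds the `3`-good twist partner and its optimal datum; part 4a = `…LeafPartnerTwist`)

HONEST FRAMING. Theorems only; helper file (`--supports stmt-BirchSwinnertonDyer-26022 --as helper`); no definition, no named
fact, no `sorry`; nothing booked, no item closed; CONDITIONAL on every displayed input — in particular on the research stub (G3)
(cokernel `3`-freeness at prime-to-`3` level) and on the print-composite PARTNER GENUS DISPLAY (Cai–Shu–Tian 2014 Thm. 1.5 for
`(V, χ₋₃∘Nm)` on `X^{S}_0(N_V/∏S)` in Zagier's covolume form read for `E = V ⊗ χ₋₃`, with the plain Kolyvagin order clause) — BSD is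
proved for no curve. Lead prover bsd-line-rhp-p2 g55, 2026-08-30.

WHAT. `leafPartnerRoadR1Pairing_of_G3_of_display_of_supply`: for a non-CM leaf curve `W` (`Addv W 3`, `SubGss W 3`) of analytic rank
one with any `X₀(N)`-datum `Dt`, on an ORPHAN-PAIRING row — SHAPE «every Tamagawa-`3` carrier is split multiplicative», an even set `S`
of odd split-multiplicative primes `ℓ` with `(−3/ℓ) = 1` (i.e. `ℓ ≡ 1 (mod 3)`: exactly the (DEG)-orphan carriers of the line of
record, Pasten Lemma 6.18 having removed the others) and the très-ramifié clause off `S` — `Typed.MissingUpperBoundAt W 3`. The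
road: `V :=` a global minimal model of `W ⊗ χ₋₃` (`W.quadraticTwist (-3)`), GOOD at `3` because the leaf fibre at `3` is Kodaira `I₀*`
(`kodairaSymbolAt_three_eq_Istar_zero_of_subGss`, `hasGoodReductionAt_quadraticTwist_of_kodairaSymbolAt_eq_Istar_zero`), so `3 ∤ N_V`;
`V[3]` irreducible (twist of an irreducible); at `ℓ ∈ S` the twist is by an `ℓ`-adic square (`(−3/ℓ) = 1`, Hensel), so `V` is split
multiplicative at `ℓ` with `c_ℓ(V) = c_ℓ(W)`, whence `ord_ℓ Δ_min(V) = ord_ℓ Δ_min(W)` (Kodaira–Néron); `V₀, D₀ :=` the optimal datum of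
`V`'s class (modularity), lattice-optimal, `3 ∤ c(D₀)` by Abbes–Ullmo (`3 ∤ N_V`); `K :=` the Friedberg–Hoffstein field with `S` inert and
every other bad prime split (`2` split unless in `S`, so `d_K` odd); then the partner pairing core (part 3) with the display instantiated
from the stub and the partner lower half from L₀. CONDITIONAL; nothing booked.

References: [cite: CaiShuTian2014, Thm. 1.1 and Thm. 1.5] [cite: PastenShimura2024, Prop. 6.13, Lemma 6.18] [cite: PapikianRabinoff2016, Thm. 37 and Remark]
[cite: AbbesUllmo1996, Thm. A] [cite: SilvermanATAEC1994, IV.11.1 table p. 368 (I₀*), Cor. IV.9.2(d)] [cite: SilvermanAEC2009, X.5 Cor. 5.4, VII.5 Prop. 5.1]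
[cite: Matsuno2009, proof of Cor. 6.2] [cite: Serre1973, Ch. II §3.3 Thm 3] [cite: FriedbergHoffstein1995, Thm. B] [cite: Stevens1989, Lemmas (5.2), (5.4)].
presearch: «quadratic twist by −3 of a Kodaira I₀* fibre at 3 is good; (−3/ℓ)=1 makes the twist an ℓ-adic square twist» → tree theorems
(Ogg/Silverman IV.11.1, Matsuno Cor. 6.2); [corpus: arXiv:1408.1733 Thm. 1.1/1.5] for the display; corpus+galaxy: no assembled partner road in print.
-/

-- D-0017: single-problem summit, so `Summit.BirchSwinnertonDyer.BirchSwinnertonDyer.…` repeats a namespace BY DESIGN.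
set_option linter.dupNamespace false
set_option autoImplicit false

noncomputable section

open scoped Classical NumberField

open WeierstrassCurve NumberField IsDedekindDomain Literature Literature.NumberTheory.EllipticCurves
  Rat.HeightOneSpectrum CongruenceSubgroup
  Literature.NumberTheory.EllipticCurves.ModularForms
  Literature.NumberTheory.EllipticCurves.Rank1Residual
  Literature.NumberTheory.EllipticCurves.Rank1Residual.Typed
  Literature.NumberTheory.QuadraticFields.Quadratic
  Literature.NumberTheory.GaloisCohomology
  Literature.NumberTheory.Automorphic
  Summit.BirchSwinnertonDyer.Rank1Residual
  Summit.BirchSwinnertonDyer.Rank1Residual.Additive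
  Summit.BirchSwinnertonDyer.Rank1Residual.X11b
  Summit.BirchSwinnertonDyer.Rank1Residual.X11b.Three
  Summit.BirchSwinnertonDyer.BirchSwinnertonDyer.Theses.RamifiedHeegnerPair
  Summit.BirchSwinnertonDyer.BirchSwinnertonDyer.Theorems
  Summit.BirchSwinnertonDyer.BirchSwinnertonDyer.Theorems.RamifiedPairUpperBound

namespace Summit.BirchSwinnertonDyer.BirchSwinnertonDyer.Theorems.LeafShimuraInert

/-! ## ROAD-R1 on the orphan-pairing rows -/

/-- **ROAD-R1 (orphan-pairing rows) ⟸ (G3) ∧ PARTNER GENUS DISPLAY ∧ FH₂ ∧ PUB⁺ ∧ JL ∧ L₀.** For a non-CM leaf curve `W`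
(`Addv W 3`, `SubGss W 3`, `r_an = 1`) with any `X₀(N)`-datum `Dt` (lattice-optimal, `3 ∤ c` — unused but part of the socket's road
binder), on an ORPHAN-PAIRING row (SHAPE; an even set `S` of odd split-multiplicative primes `ℓ` with `(−3/ℓ) = 1`; très-ramifié clause
off `S`): `Typed.MissingUpperBoundAt W 3`. Hypotheses: `hG3` = the body of `Partnerdescent.PartnerCokernelThreeFree`; `hDisp` = the
body of the partner genus display stub (HKat-form, sourced from the `3`-good partner's class-minimal Shimura datum); FH₂
`friedbergHoffstein_exists_twist_ne_zero_inertAt_splitAt`; PUB⁺; JL; L₀ `Gss2LowerAtThreeRankZero` by name. Proof: `…LeafPartnerTwist` (partner good at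
`3`, split at `S` with equal `ord_ℓ Δ_min`), the optimal datum of the partner's class (`exists_optimal_modularParametrizationData_of_modularity`,
`latticeEq_of_forall_modularDegree_le`, Abbes–Ullmo), the FH field, and the partner pairing core. CONDITIONAL; nothing booked; BSD not proved.
[cite: CaiShuTian2014, Thm. 1.5] [cite: PapikianRabinoff2016, Thm. 37 and Remark] [cite: AbbesUllmo1996, Thm. A] [cite: FriedbergHoffstein1995, Thm. B] -/
theorem leafPartnerRoadR1Pairing_of_G3_of_display_of_supply
    (hG3 : ∃ cI cJ : ComponentOrderFun,
      (∀ {D M : ℕ} {X : ShimuraCurveData D M} {W' : WeierstrassCurve ℚ}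
          (P : ShimuraParametrizationData X W') (p : ℕ), 0 < cI P p ∧ 0 < cJ P p) ∧
      ComponentOrders.ProductEq cI cJ ∧ ComponentOrders.Prop613 cI cJ ∧
      ComponentOrders.ImageEisenstein cI ∧ ComponentOrders.CokernelDvd cJ ∧
      (∀ {N D M : ℕ}, IsAdmissibleFactorization N D M →
        ∀ (X : ShimuraCurveData D M) (V : WeierstrassCurve ℚ) [V.IsElliptic] [V.IsGloballyMinimal],
          V.conductorNorm ℤ = N → ¬ 3 ∣ N → Irr V 3 →
        ∀ (V' : WeierstrassCurve ℚ) [V'.IsElliptic] (P : ShimuraParametrizationData X V'),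
          P.IsMinimalFor V → ∀ p : ℕ, p.Prime → p ∣ D → ¬ 3 ∣ cJ P p))
    (hDisp : ∀ (W : WeierstrassCurve ℚ) [W.IsElliptic] [W.IsGloballyMinimal] (N : ℕ) [NeZero N]
      (Dt : ModularParametrizationData W N),
      ¬ W.HasCM → Addv W 3 → SubGss W 3 → W.conductorNorm ℤ = N →
      ∀ (V : WeierstrassCurve ℚ) [V.IsElliptic] [V.IsGloballyMinimal] (CV : VariableChange ℚ),
        CV • W.quadraticTwist (-3) = V →
      ∀ (NV : ℕ) [NeZero NV] (V₀ : WeierstrassCurve ℚ) [V₀.IsElliptic] [V₀.IsGloballyMinimal]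
        (D₀ : ModularParametrizationData V₀ NV),
        V.conductorNorm ℤ = NV → IsNewformOf V D₀.f →
        (∀ (V₂ : WeierstrassCurve ℚ) [V₂.IsElliptic] (D₂ : ModularParametrizationData V₂ NV),
          D₂.f = D₀.f → D₀.modularDegree ≤ D₂.modularDegree) →
      ∀ (K : Type) [Field K] [NumberField K] (S : Finset ℕ)
        (X : ShimuraCurveData (∏ q ∈ S, q) (NV / ∏ q ∈ S, q))
        (V' : WeierstrassCurve ℚ) [V'.IsElliptic] (P₀ : ShimuraParametrizationData X V'),
        IsImaginaryQuadratic K → Odd (NumberField.discr K) → Even S.card →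
        (∀ ℓ ∈ S, ∃ _ : Fact ℓ.Prime, W.HasMultiplicativeReductionAtPrime ℓ ∧
          ((Ideal.span {(ℓ : ℤ)}).primesOver (𝓞 K)).ncard = 1 ∧ ¬ (ℓ : ℤ) ∣ NumberField.discr K) →
        (∀ ℓ : ℕ, ℓ.Prime → ℓ ∣ N → ℓ ∉ S → ((Ideal.span {(ℓ : ℤ)}).primesOver (𝓞 K)).ncard = 2) →
        P₀.IsMinimalFor V →
        ∃ (P : (W.baseChange K).toAffine.Point) (degS : ℕ), 0 < degS ∧
          padicValNat 3 degS = padicValNat 3 P₀.deg ∧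
          (degS : ℂ) * LDerivEK W K =
            ((2 * ZLattice.covolume Dt.L.lattice * (D₀.modularDegree : ℝ) /
                ((D₀.c : ℝ) ^ 2 * ((Units.torsionOrder K : ℝ) / 2) ^ 2 * √|(NumberField.discr K : ℝ)|) *
              P.canonicalHeight : ℝ) : ℂ) ∧
          (¬ IsOfFinAddOrder P →
            Nat.card (AddCommGroup.primaryComponent (W.baseChange K).sha 3) ≤
              3 ^ (2 * padicValNat 3 (AddSubgroup.zmultiples P).index)))
    (hFH2 : friedbergHoffstein_exists_twist_ne_zero_inertAt_splitAt)
    (hpub : LeafRankOnePrintedInputsAtThree)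
    (hJL : nonempty_shimuraParametrizationData)
    (hL0 : Gss2LowerAtThreeRankZero) :
    ∀ (W : WeierstrassCurve ℚ) [W.IsElliptic] [W.IsGloballyMinimal] (N : ℕ) [NeZero N]
      (Dt : ModularParametrizationData W N),
      ¬ W.HasCM → Addv W 3 → SubGss W 3 → W.analyticRank = 1 → W.conductorNorm ℤ = N →
      (∀ z ∈ Dt.L.lattice, ∃ w ∈ periodLattice Dt.f, z = Dt.c * w) → ¬ (3 : ℤ) ∣ Dt.c →
      (∀ (q : ℕ) [Fact q.Prime], 3 ∣ (W.baseChange ℚ_[q]).localTamagawaNumber ℤ_[q] →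
        W.HasSplitMultiplicativeReductionAtPrime q) →
      (∃ S : Finset ℕ, Even S.card ∧
        (∀ ℓ ∈ S, ∃ _ : Fact ℓ.Prime, W.HasSplitMultiplicativeReductionAtPrime ℓ ∧ ℓ ≠ 2 ∧ jacobiSym (-3) ℓ = 1) ∧
        (∀ (ℓ : ℕ) [Fact ℓ.Prime], ℓ ∉ S → W.HasSplitMultiplicativeReductionAtPrime ℓ →
          ¬ 3 ∣ padicValInt ℓ W.minimalDiscriminantInt)) →
      MissingUpperBoundAt W 3 := by
  obtain ⟨-, -, hGZK, hmod, -, -, hnf, -, -, -, -, hAU, -⟩ := hpub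
  intro W _ _ N _ Dt hCM hadd hsub hr hN _ _ hshape hrow
  obtain ⟨S, hSeven, hS, hFC⟩ := hrow
  subst hN
  haveI h3F : Fact (Nat.Prime 3) := ⟨Nat.prime_three⟩
  have hp : (3 : ℕ).Prime := Nat.prime_three
  have hirr : W.HasIrreducibleModPGaloisRep 3 := Additive.irr_of_subGss_of_ne_two W 3 (by decide) hadd hsub
  have hSmult : ∀ ℓ ∈ S, ∃ _ : Fact ℓ.Prime, W.HasMultiplicativeReductionAtPrime ℓ := fun ℓ hℓ ↦ by
    obtain ⟨hℓF, hs, -, -⟩ := hS ℓ hℓ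
    exact ⟨hℓF, hs.toHasMultiplicativeReduction⟩
  ---------------------------------------------------------------- the `3`-good partner `V`
  have hd : (-3 : ℚ) ≠ 0 := by norm_num
  haveI hEt : (W.quadraticTwist (-3 : ℚ)).IsElliptic := W.isElliptic_quadraticTwist hd
  obtain ⟨CV, hCVmin⟩ := hasGlobalMinimalModel_rat_holds (W.quadraticTwist (-3 : ℚ))
  haveI : (CV • W.quadraticTwist (-3 : ℚ)).IsGloballyMinimal := hCVmin
  set V : WeierstrassCurve ℚ := CV • W.quadraticTwist (-3 : ℚ) with hV_def
  have hV : CV • W.quadraticTwist (-3 : ℚ) = V := rfl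
  have hgoodV : V.HasGoodReductionAtPrime 3 := hasGoodReductionAtPrime_three_of_smul_eq_quadraticTwist_negThree W hadd hsub CV hV
  have hNV0 : V.conductorNorm ℤ ≠ 0 := (V.conductorNorm_pos_holds).ne'
  haveI : NeZero (V.conductorNorm ℤ) := ⟨hNV0⟩
  have h3NV : ¬ 3 ∣ V.conductorNorm ℤ := fun h ↦
    ((V.dvd_conductorNorm_iff_not_hasGoodReductionAtPrime 3).mp h) hgoodV
  have hirrV : V.HasIrreducibleModPGaloisRep 3 := by
    rw [← hV, Mazur1978.hasIrreducibleModPGaloisRep_smul_iff]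
    refine hasIrreducibleModPGaloisRep_quadraticTwist W ?_ 3 hirr
    rintro ⟨r, hr⟩
    nlinarith [mul_self_nonneg r]
  -- at the primes of `S`: split multiplicative for `V`, same `ord_ℓ Δ_min`
  have hSV : ∀ ℓ ∈ S, ∃ _ : Fact ℓ.Prime, V.HasSplitMultiplicativeReductionAtPrime ℓ ∧
      padicValInt ℓ V.minimalDiscriminantInt = padicValInt ℓ W.minimalDiscriminantInt := fun ℓ hℓ ↦ by
    obtain ⟨hℓF, hs, hℓ2, hJ⟩ := hS ℓ hℓ
    exact ⟨hℓF, split_and_ordDiscr_eq_of_smul_eq_quadraticTwist_negThree W CV hV ℓ hℓ2 hJ hs⟩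
  have hSmultV : ∀ ℓ ∈ S, ∃ _ : Fact ℓ.Prime, V.HasMultiplicativeReductionAtPrime ℓ := fun ℓ hℓ ↦ by
    obtain ⟨hℓF, hs, -⟩ := hSV ℓ hℓ
    exact ⟨hℓF, hs.toHasMultiplicativeReduction⟩
  have hΔS : ∀ ℓ ∈ S, padicValInt ℓ V.minimalDiscriminantInt = padicValInt ℓ W.minimalDiscriminantInt := fun ℓ hℓ ↦ by
    obtain ⟨_, -, h⟩ := hSV ℓ hℓ
    exact h
  ---------------------------------------------------------------- the optimal datum of the partner's class, `3 ∤ c`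
  obtain ⟨V₀, hV₀, hV₀m, D₀, hfV, -, hminV⟩ :=
    exists_optimal_modularParametrizationData_of_modularity hnf (V.conductorNorm ℤ) V rfl
  haveI := hV₀
  haveI := hV₀m
  have hoptV : ∀ z ∈ D₀.L.lattice, ∃ w ∈ periodLattice D₀.f, z = D₀.c * w :=
    D₀.latticeEq_of_forall_modularDegree_le hminV
  have hcV : ¬ (3 : ℤ) ∣ D₀.c := hAU V₀ D₀ hoptV 3 hp h3NV
  ---------------------------------------------------------------- the Friedberg–Hoffstein field (JSW §7.4.2), `2` split unless inert
  have hw : W.rootNumber = -1 := by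
    rw [WeierstrassCurve.rootNumber_eq_neg_one_pow_analyticRank_of_exists_isNewformOf hnf W, hr]
    norm_num
  obtain ⟨K, _, _, hK, -, hinert, hsplitN, hsplit2, hLt⟩ := hFH2 W hw S hSmult hSeven 2 two_ne_zero 4
  have hodd : Odd (NumberField.discr K) := by
    by_cases h2S : 2 ∈ S
    · obtain ⟨hn, hd2⟩ := hinert 2 h2S
      exact odd_discr_of_two_inert_or_split hK.1
        (Or.inl ⟨by simpa only [Nat.cast_ofNat] using hn, by simpa only [Nat.cast_ofNat] using hd2⟩)
    · have hn := hsplit2 2 Nat.prime_two (dvd_refl 2) h2S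
      exact odd_discr_of_two_inert_or_split hK.1 (Or.inr (by simpa only [Nat.cast_ofNat] using hn))
  obtain ⟨-, -, hH3, -⟩ := jswField_localData W hadd S hSmult K hinert hsplitN
  have hSin : ∀ ℓ ∈ S, ∃ _ : Fact ℓ.Prime, W.HasMultiplicativeReductionAtPrime ℓ ∧
      ((Ideal.span {(ℓ : ℤ)}).primesOver (𝓞 K)).ncard = 1 ∧ ¬ (ℓ : ℤ) ∣ NumberField.discr K := fun ℓ hℓ ↦ by
    obtain ⟨hℓF, hm⟩ := hSmult ℓ hℓ
    exact ⟨hℓF, hm, hinert ℓ hℓ⟩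
  ---------------------------------------------------------------- the partner pairing core
  exact leafRankOneUpper_three_of_partnerDatum_at_pairing hGZK hmod hnf hJL hG3 W hadd hsub hr rfl Dt V rfl h3NV hirrV V₀ D₀ hfV
    hminV hcV S hSeven hSmult hSmultV hΔS (fun ℓ _ hℓS hs ↦ hFC ℓ hℓS hs) hshape K hK hodd hinert hsplitN hLt
    (fun X V' _ P₀ hP₀ ↦ hDisp W (W.conductorNorm ℤ) Dt hCM hadd hsub rfl V CV hV (V.conductorNorm ℤ) V₀ D₀ rfl hfV hminV K S X V' P₀ hK
      hodd hSeven hSin hsplitN hP₀)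
    (fun Wd _ _ Cd hWd ↦ partnerLowerSplitThree_of_lowerRankZero hmod hL0 W hCM hadd hsub K hK hodd hH3 hLt Wd Cd hWd)

end Summit.BirchSwinnertonDyer.BirchSwinnertonDyer.Theorems.LeafShimuraInert

end
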